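import Summits.NavierStokesRegularity.NavierStokesRegularity.Theses.AxisymmetricExtremality
import Summits.NavierStokesRegularity.NavierStokesRegularity.Theorems.AxisymmetricExtremalityAxisymmetricKatoGlobalStubSereginLogSwirlOriginLemma21LocalIdentity
import Summits.NavierStokesRegularity.NavierStokesRegularity.Theorems.AxisymmetricExtremalityAxisymmetricKatoGlobalStubSereginLogSwirlOriginCFZBounds
import Literature.Analysis.FluidPDE.HouLeiLiEstimate
import Literature.Analysis.FluidPDE.AxisymGradientField
import HarnessLib

/-!
# Seregin 2022, Lemma 2.1, localised: `∫|∇(u_r/r)|² ≤ ∫(ω_θ/r)² − 2∫(u_r/r)·(1/r)∂ᵣ(div u)` and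
# `∫|∇²(u_r/r)|² ≤ ∫(∂₃(ω_θ/r) + (1/r)∂ᵣ(div u))²` for compactly supported axisymmetric fields
# that are NOT divergence free — crux stmt-NavierStokesRegularity-15453
# (`AxisymmetricExtremality.AxisymmetricKatoGlobal`), line registered, support for stub
# `stub_sereginLogSwirlOrigin`

Support file (`--supports stmt-NavierStokesRegularity-15453`; theorems only, everything proved)
toward the registered stub `stub_sereginLogSwirlOrigin` = the named fact
`Literature.Analysis.FluidPDE.seregin2022_logSwirl_regularAtOrigin` (G. Seregin, J. Math. Fluid
Mech. 24 (2022), Paper 27 = arXiv:2201.00153, §2). Step 2 there is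

> **Lemma 2.1.** Let `v̄ = v_re_r + v₃e₃` … and `Γ = ω_θ/r`. Then, for all `t ∈ ]-1,0[`,
> `‖∇(η³v_r/r)(·,t)‖_{2,𝒞} ≤ c‖η³Γ(·,t)‖_{2,𝒞} + C(v,η)`,
> `‖∇̄²(η³v_r/r)(·,t)‖_{2,𝒞} ≤ c‖η³Γ,₃(·,t)‖_{2,𝒞} + C(v,η)`,

proved by localising the div–curl system to `ζv̄`, `ζ = η³`: "`div(ζv̄) = v̄·∇ζ`,
`curl(ζv̄) = ζω_θe_θ + ∇ζ × v̄`" (arXiv p. 5), the source `v̄·∇ζ` living on `supp |∇η|` where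
`v, ∇v, ∇²v` are bounded, whence `C(v,η)`. The tree route to the global (divergence-free) core
avoids the Biot–Savart / Calderón–Zygmund passage of the paper: `Δρ + 2q_ρ = ∂₂Γ`
(`ρ = radVelQuot u = u_r/r`, `Γ = angVortQuot u = ω_θ/r`, `q_F = radDerivQuot F = (∂ᵣF)/r`) and
two whole-space integrations by parts (`HouLeiLiEstimate`, sibling `…CFZBounds`). This file runs
the same two integrations by parts on the identity WITH the divergence source,
`Δρ + 2q_ρ = ∂₂Γ + q_{div u}` (sibling `…Lemma21LocalIdentity`, `laplacian_radVelQuot_add_eq`),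
for every axisymmetric `u : ℝ³ → ℝ³` with compact support (the localised field `ζv̄` is of this
kind), and obtains Lemma 2.1 in the form with explicit error terms:

* `integral_gradSq_radVelQuot_le_sub_of_hasCompactSupport` (registered sub-goal; `u ∈ C⁴`) —
  `∫ Σᵢ(∂ᵢρ)² ≤ ∫ Γ² − 2 ∫ ρ · q_{div u}`
  (pair the identity with `ρ`: `∫|∇ρ|² − 2∫ρq_ρ = ∫Γ∂₂ρ − ∫ρ q_{div u}`, `∫ρq_ρ ≤ 0` is the axis
  term, `∫Γ∂₂ρ ≤ ½∫Γ² + ½∫(∂₂ρ)²`);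
* `integral_hessianSq_radVelQuot_le_of_hasCompactSupport'` (registered sub-goal; `u ∈ C⁵`) —
  `∫ Σᵢⱼ(∂ⱼ∂ᵢρ)² ≤ ∫ (∂₂Γ + q_{div u})²`
  (`∫Σᵢⱼ(∂ⱼ∂ᵢρ)² = ∫(Δρ)² ≤ ∫(Δρ + 2q_ρ)²`, `integral_laplacian_sq_le`), and the split form
  `integral_hessianSq_radVelQuot_le_two_mul_add` — `≤ 2∫(∂₂Γ)² + 2∫q_{div u}²`.

For `div u = 0` these are the tree's Chen–Fang–Zhang / Lei–Zhang bounds with constant `1`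
(`integral_gradSq_radVelQuot_le_of_hasCompactSupport`,
`integral_hessianSq_radVelQuot_le_of_hasCompactSupport`). For `u = ζv` (`v` smooth, axisymmetric
and divergence free near `tsupport ζ`): `div u = v·∇ζ`, so `q_{div u}` is supported in
`tsupport ζ ∩ supp |∇ζ|` and the two error terms are the printed `C(v,η)` (sibling file
`…Lemma21LocalCutoff`, the product rules for `radVelQuot (ζ • v)`, `angVortQuot (ζ • v)`).

## Mathlib / tree search

Tree inputs: `laplacian_radVelQuot_add_eq`, `isAxisymmetricScalar_divergence`
(`…Lemma21LocalIdentity`); `hasCompactSupport_radVelQuot/angVortQuot/radDerivQuot`,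
`memLp_fderiv_apply_of_hasCompactSupport`, `memLp_fderiv_fderiv_apply_of_hasCompactSupport`
(`…CFZBounds`); `IsAxisymmetricScalar.integral_mul_radDerivQuot_nonpos`,
`integral_mul_fderiv_fderiv_eq_neg_sq`, `integral_mul_fderiv_eq_neg_of_differentiable`,
`integral_laplacian_sq_le` (`HouLeiLiEstimate`, model `IsAxisymmetric.integral_gradSq_radVelQuot_le`);
`memLp_coord_mul_fderiv_radDerivQuot`, `integral_sum_sq_fderiv_fderiv_eq_integral_laplacian_sq_of_memLp`
(`AxisymGradientField`); `contDiff_divergence`, `divergence_eq_sum_three`. Mathlib: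
`Continuous.memLp_of_hasCompactSupport`, `HasCompactSupport.mono'`, `fderiv_of_notMem_tsupport`.
`lean search 'integral_gradSq_radVelQuot_le_sub|integral_hessianSq_radVelQuot_le_of_hasCompactSupport.|hasCompactSupport_divergence_of'`:
no matches (2026-08-17; `hasCompactSupport_divergence` exists in `CalderonSplittingLp`, outside
this import cone).

## References

* G. Seregin, J. Math. Fluid Mech. 24 (2022), Paper No. 27 = arXiv:2201.00153, §2, Lemma 2.1
  and its proof (arXiv p. 5). [`Seregin2022LocalAxisym`]
* Z. Lei, Q. S. Zhang, Pacific J. Math. 289 (2017) 169–187 = arXiv:1505.02628, Lemma 2.1;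
  H. Chen, D. Fang, T. Zhang, Discrete Contin. Dyn. Syst. 37 (2017) 1923–1939, Lemma 2.3.
  [`LeiZhang2017`, `ChenFangZhang2017`]
-/

noncomputable section

open MeasureTheory Set Filter Topology Function
open scoped ENNReal ContDiff Laplacian
open Literature.Analysis.FluidPDE

-- `<Problem> = <Summit>` duplicates a namespace component by design (lakefile sets the same option).
set_option linter.dupNamespace false

namespace Summit.NavierStokesRegularity.NavierStokesRegularity.Theorems.AxisymmetricKatoGlobal.EulerScaling

variable {u : EuclideanSpace ℝ (Fin 3) → EuclideanSpace ℝ (Fin 3)}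

/-! ### Compact support of the divergence and of its radial derivative quotient -/

/-- The divergence of a compactly supported field is compactly supported
(`support ⊆ tsupport u`: off `tsupport u` the derivative vanishes). [folklore] -/
theorem hasCompactSupport_divergence_of_hasCompactSupport (hc : HasCompactSupport u) :
    HasCompactSupport (VectorCalculus.divergence u) := by
  refine hc.mono' fun x hx => ?_
  by_contra h
  apply hx
  rw [divergence_eq_sum_three, fderiv_of_notMem_tsupport ℝ h]
  simp

/-- `q_{div u} = (1/r)∂ᵣ(div u) ∈ L²(ℝ³)` for a compactly supported axisymmetric `u ∈ C⁴`
(`div u` is a compactly supported axisymmetric `C³` scalar, so `radDerivQuot (div u)` is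
continuous with compact support). [folklore] -/
theorem memLp_radDerivQuot_divergence (hu : ContDiff ℝ 4 u) (hc : HasCompactSupport u)
    (hax : IsAxisymmetric u) :
    MemLp (radDerivQuot (VectorCalculus.divergence u)) 2 volume := by
  have hD2 : ContDiff ℝ 2 (VectorCalculus.divergence u) :=
    contDiff_divergence (n := 2) (by exact_mod_cast hu.of_le (by norm_num))
  exact (continuous_radDerivQuot hD2).memLp_of_hasCompactSupport
    (hasCompactSupport_radDerivQuot hD2 (isAxisymmetricScalar_divergence hax)
      (hasCompactSupport_divergence_of_hasCompactSupport hc))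

/-! ### Lemma 2.1, first estimate, with the divergence error term -/

/-- **Seregin 2022, Lemma 2.1, first estimate, localised form with explicit error term**:
for every axisymmetric `u ∈ C⁴(ℝ³; ℝ³)` with compact support (divergence free or not),
`∫ Σᵢ (∂ᵢ(u_r/r))² ≤ ∫ (ω_θ/r)² − 2 ∫ (u_r/r) · (1/r)∂ᵣ(div u)`, i.e.
`∫|∇ρ|² ≤ ∫Γ² − 2∫ρ q_{div u}` with `ρ = radVelQuot u`, `Γ = angVortQuot u`,
`q_{div u} = radDerivQuot (div u)`. Proof: pair `Δρ + 2q_ρ = ∂₂Γ + q_{div u}`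
(`laplacian_radVelQuot_add_eq`) with `ρ` and integrate by parts on `ℝ³`:
`−∫|∇ρ|² + 2∫ρq_ρ = −∫Γ∂₂ρ + ∫ρq_{div u}`, where `∫ρq_ρ ≤ 0` (axis term,
`IsAxisymmetricScalar.integral_mul_radDerivQuot_nonpos`) and `∫Γ∂₂ρ ≤ ½∫Γ² + ½∫(∂₂ρ)²`. For
`div u = 0` this is Lei–Zhang's Lemma 2.1 / Chen–Fang–Zhang's Lemma 2.3 with constant `1`; for
`u = ζv̄` the error term is Seregin's `C(v,η)` (`div(ζv̄) = v̄·∇ζ` lives on `supp |∇ζ|`).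
Registered sub-goal toward `stub_sereginLogSwirlOrigin`. [cite: Seregin2022LocalAxisym, §2 Lemma 2.1, first estimate (arXiv:2201.00153 p. 5)] [cite: LeiZhang2017, Lemma 2.1 (first estimate)] -/
theorem integral_gradSq_radVelQuot_le_sub_of_hasCompactSupport : ∀ u : EuclideanSpace ℝ (Fin 3) → EuclideanSpace ℝ (Fin 3), ContDiff ℝ 4 u → HasCompactSupport u → IsAxisymmetric u → ∫ x, (fderiv ℝ (radVelQuot u) x (EuclideanSpace.single 0 1) ^ 2 + fderiv ℝ (radVelQuot u) x (EuclideanSpace.single 1 1) ^ 2 + fderiv ℝ (radVelQuot u) x (EuclideanSpace.single 2 1) ^ 2) ≤ (∫ x, angVortQuot u x ^ 2) - 2 * ∫ x, radVelQuot u x * radDerivQuot (VectorCalculus.divergence u) x := by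
  intro u hu hc hax
  -- regularity, support and square integrability of everything that is paired
  have hu2 : ContDiff ℝ 2 u := hu.of_le (by norm_num)
  have hu3 : ContDiff ℝ 3 u := hu.of_le (by norm_num)
  have hρ2 : ContDiff ℝ 2 (radVelQuot u) := contDiff_radVelQuot (n := 2) (by exact_mod_cast hu)
  have hρ1 : ContDiff ℝ 1 (radVelQuot u) := hρ2.of_le (by norm_num)
  have hρd : Differentiable ℝ (radVelQuot u) := hρ2.differentiable two_ne_zero
  have hρax : IsAxisymmetricScalar (radVelQuot u) := hax.isAxisymmetricScalar_radVelQuot hu2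
  have hρc : HasCompactSupport (radVelQuot u) := hasCompactSupport_radVelQuot hu2 hax hc
  have hω1 : ContDiff ℝ 1 (angVortQuot u) := contDiff_angVortQuot (n := 1) (by exact_mod_cast hu)
  have hωd : Differentiable ℝ (angVortQuot u) := hω1.differentiable one_ne_zero
  have hωc : HasCompactSupport (angVortQuot u) := hasCompactSupport_angVortQuot hu3 hax hc
  have hρ : MemLp (radVelQuot u) 2 volume := hρ2.continuous.memLp_of_hasCompactSupport hρc
  have hq : MemLp (radDerivQuot (radVelQuot u)) 2 volume :=
    (continuous_radDerivQuot hρ2).memLp_of_hasCompactSupport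
      (hasCompactSupport_radDerivQuot hρ2 hρax hρc)
  have hqD : MemLp (radDerivQuot (VectorCalculus.divergence u)) 2 volume :=
    memLp_radDerivQuot_divergence hu hc hax
  have hG := memLp_fderiv_apply_of_hasCompactSupport hρ1 hρc
  have hGG := memLp_fderiv_fderiv_apply_of_hasCompactSupport hρ2 hρc
  have hω : MemLp (angVortQuot u) 2 volume := hω1.continuous.memLp_of_hasCompactSupport hωc
  have hωz := memLp_fderiv_apply_of_hasCompactSupport hω1 hωc (EuclideanSpace.single 2 1)
  -- (i) `∫ ρ ∂ᵢ∂ᵢρ = −∫ (∂ᵢρ)²`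
  have hI0 := integral_mul_fderiv_fderiv_eq_neg_sq hρ2 (EuclideanSpace.single 0 1) hρ (hG _)
    (hGG _ _)
  have hI1 := integral_mul_fderiv_fderiv_eq_neg_sq hρ2 (EuclideanSpace.single 1 1) hρ (hG _)
    (hGG _ _)
  have hI2 := integral_mul_fderiv_fderiv_eq_neg_sq hρ2 (EuclideanSpace.single 2 1) hρ (hG _)
    (hGG _ _)
  -- (ii) the axis term has a sign
  have hax' := hρax.integral_mul_radDerivQuot_nonpos hρ2 hρ hq
  -- (iii) `∫ ρ ∂₂Γ = −∫ ∂₂ρ Γ`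
  have hibp := integral_mul_fderiv_eq_neg_of_differentiable hρd hωd (EuclideanSpace.single 2 1)
    ((hG _).integrable_mul hω) (hρ.integrable_mul hωz) (hρ.integrable_mul hω)
  -- the identity paired with `ρ`
  have hid : ∀ x, radVelQuot u x *
      fderiv ℝ (fun y => fderiv ℝ (radVelQuot u) y (EuclideanSpace.single 0 1)) x
          (EuclideanSpace.single 0 1) + radVelQuot u x *
        fderiv ℝ (fun y => fderiv ℝ (radVelQuot u) y (EuclideanSpace.single 1 1)) x
          (EuclideanSpace.single 1 1) + radVelQuot u x *
        fderiv ℝ (fun y => fderiv ℝ (radVelQuot u) y (EuclideanSpace.single 2 1)) x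
          (EuclideanSpace.single 2 1) + 2 * (radVelQuot u x * radDerivQuot (radVelQuot u) x) =
      radVelQuot u x * fderiv ℝ (angVortQuot u) x (EuclideanSpace.single 2 1) +
        radVelQuot u x * radDerivQuot (VectorCalculus.divergence u) x := by
    intro x
    have h := laplacian_radVelQuot_add_eq u hax hu x
    rw [laplacian_eq_sum_fderiv_fderiv (EuclideanSpace.basisFun (Fin 3) ℝ) hρ2 x] at h
    simp only [EuclideanSpace.basisFun_apply, Fin.sum_univ_three] at h
    linear_combination radVelQuot u x * h
  -- integrability of the pieces
  have hJ0 : Integrable fun x => radVelQuot u x *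
      fderiv ℝ (fun y => fderiv ℝ (radVelQuot u) y (EuclideanSpace.single 0 1)) x
        (EuclideanSpace.single 0 1) := hρ.integrable_mul (hGG _ _)
  have hJ1 : Integrable fun x => radVelQuot u x *
      fderiv ℝ (fun y => fderiv ℝ (radVelQuot u) y (EuclideanSpace.single 1 1)) x
        (EuclideanSpace.single 1 1) := hρ.integrable_mul (hGG _ _)
  have hJ2 : Integrable fun x => radVelQuot u x *
      fderiv ℝ (fun y => fderiv ℝ (radVelQuot u) y (EuclideanSpace.single 2 1)) x
        (EuclideanSpace.single 2 1) := hρ.integrable_mul (hGG _ _)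
  have hJq : Integrable fun x => radVelQuot u x * radDerivQuot (radVelQuot u) x :=
    hρ.integrable_mul hq
  have hJ2q : Integrable fun x => 2 * (radVelQuot u x * radDerivQuot (radVelQuot u) x) :=
    hJq.const_mul 2
  have hJΓ : Integrable fun x =>
      radVelQuot u x * fderiv ℝ (angVortQuot u) x (EuclideanSpace.single 2 1) :=
    hρ.integrable_mul hωz
  have hJD : Integrable fun x => radVelQuot u x * radDerivQuot (VectorCalculus.divergence u) x :=
    hρ.integrable_mul hqD
  have hJ01 : Integrable fun x => radVelQuot u x *
      fderiv ℝ (fun y => fderiv ℝ (radVelQuot u) y (EuclideanSpace.single 0 1)) x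
        (EuclideanSpace.single 0 1) + radVelQuot u x *
      fderiv ℝ (fun y => fderiv ℝ (radVelQuot u) y (EuclideanSpace.single 1 1)) x
        (EuclideanSpace.single 1 1) := hJ0.add hJ1
  have hJ012 : Integrable fun x => radVelQuot u x *
      fderiv ℝ (fun y => fderiv ℝ (radVelQuot u) y (EuclideanSpace.single 0 1)) x
        (EuclideanSpace.single 0 1) + radVelQuot u x *
      fderiv ℝ (fun y => fderiv ℝ (radVelQuot u) y (EuclideanSpace.single 1 1)) x
        (EuclideanSpace.single 1 1) + radVelQuot u x *
      fderiv ℝ (fun y => fderiv ℝ (radVelQuot u) y (EuclideanSpace.single 2 1)) x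
        (EuclideanSpace.single 2 1) := hJ01.add hJ2
  have hJΓD : Integrable fun x =>
      radVelQuot u x * fderiv ℝ (angVortQuot u) x (EuclideanSpace.single 2 1) +
        radVelQuot u x * radDerivQuot (VectorCalculus.divergence u) x := hJΓ.add hJD
  -- integrate the paired identity
  have hsum : (∫ x, radVelQuot u x *
      fderiv ℝ (fun y => fderiv ℝ (radVelQuot u) y (EuclideanSpace.single 0 1)) x
        (EuclideanSpace.single 0 1)) + (∫ x, radVelQuot u x *
      fderiv ℝ (fun y => fderiv ℝ (radVelQuot u) y (EuclideanSpace.single 1 1)) x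
        (EuclideanSpace.single 1 1)) + (∫ x, radVelQuot u x *
      fderiv ℝ (fun y => fderiv ℝ (radVelQuot u) y (EuclideanSpace.single 2 1)) x
        (EuclideanSpace.single 2 1)) +
      2 * (∫ x, radVelQuot u x * radDerivQuot (radVelQuot u) x) =
      (∫ x, radVelQuot u x * fderiv ℝ (angVortQuot u) x (EuclideanSpace.single 2 1)) +
        ∫ x, radVelQuot u x * radDerivQuot (VectorCalculus.divergence u) x := by
    rw [← integral_add hJ0 hJ1, ← integral_add hJ01 hJ2, ← integral_const_mul,
      ← integral_add hJ012 hJ2q, ← integral_add hJΓ hJD]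
    exact integral_congr_ae (Eventually.of_forall fun x => hid x)
  rw [hI0, hI1, hI2, hibp] at hsum
  -- Young: `∫ ∂₂ρ Γ ≤ ½∫Γ² + ½∫(∂₂ρ)²`
  have hY : ∫ x, fderiv ℝ (radVelQuot u) x (EuclideanSpace.single 2 1) * angVortQuot u x ≤
      (1 / 2) * (∫ x, angVortQuot u x ^ 2) +
        (1 / 2) * ∫ x, fderiv ℝ (radVelQuot u) x (EuclideanSpace.single 2 1) ^ 2 := by
    have hIa : Integrable fun x => 1 / 2 * angVortQuot u x ^ 2 := hω.integrable_sq.const_mul _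
    have hIb : Integrable fun x =>
        1 / 2 * fderiv ℝ (radVelQuot u) x (EuclideanSpace.single 2 1) ^ 2 :=
      (hG _).integrable_sq.const_mul _
    rw [← integral_const_mul, ← integral_const_mul, ← integral_add hIa hIb]
    refine integral_mono ((hG _).integrable_mul hω) (hIa.add hIb) fun x => ?_
    beta_reduce
    nlinarith [sq_nonneg (fderiv ℝ (radVelQuot u) x (EuclideanSpace.single 2 1) - angVortQuot u x)]
  -- the three squares
  have hS : ∫ x, (fderiv ℝ (radVelQuot u) x (EuclideanSpace.single 0 1) ^ 2 +
        fderiv ℝ (radVelQuot u) x (EuclideanSpace.single 1 1) ^ 2 +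
        fderiv ℝ (radVelQuot u) x (EuclideanSpace.single 2 1) ^ 2) =
      (∫ x, fderiv ℝ (radVelQuot u) x (EuclideanSpace.single 0 1) ^ 2) +
        (∫ x, fderiv ℝ (radVelQuot u) x (EuclideanSpace.single 1 1) ^ 2) +
        ∫ x, fderiv ℝ (radVelQuot u) x (EuclideanSpace.single 2 1) ^ 2 := by
    have h01 : Integrable fun x => fderiv ℝ (radVelQuot u) x (EuclideanSpace.single 0 1) ^ 2 +
        fderiv ℝ (radVelQuot u) x (EuclideanSpace.single 1 1) ^ 2 :=
      (hG _).integrable_sq.add (hG _).integrable_sq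
    rw [integral_add h01 (hG _).integrable_sq, integral_add (hG _).integrable_sq (hG _).integrable_sq]
  have hnn0 : 0 ≤ ∫ x, fderiv ℝ (radVelQuot u) x (EuclideanSpace.single 0 1) ^ 2 :=
    integral_nonneg fun x => sq_nonneg _
  have hnn1 : 0 ≤ ∫ x, fderiv ℝ (radVelQuot u) x (EuclideanSpace.single 1 1) ^ 2 :=
    integral_nonneg fun x => sq_nonneg _
  rw [hS]
  linarith [hsum, hY, hax', hnn0, hnn1]

/-! ### Lemma 2.1, second estimate, with the divergence error term -/

/-- **Seregin 2022, Lemma 2.1, second estimate, localised form with explicit error term**: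
for every axisymmetric `u ∈ C⁵(ℝ³; ℝ³)` with compact support (divergence free or not),
`∫ Σᵢⱼ (∂ⱼ∂ᵢ(u_r/r))² ≤ ∫ (∂₃(ω_θ/r) + (1/r)∂ᵣ(div u))²`, i.e.
`∫|∇²ρ|² ≤ ∫(∂₂Γ + q_{div u})²`. Proof: `∫Σᵢⱼ(∂ⱼ∂ᵢρ)² = ∫(Δρ)²` (Hessian–Laplacian identity in
`L²`), `∫(Δρ)² ≤ ∫(Δρ + 2q_ρ)²` (`integral_laplacian_sq_le`: the cross term is
`8∫q_ρ² + 4∫∂₂∂₂ρ q_ρ ≥ 0`), and `Δρ + 2q_ρ = ∂₂Γ + q_{div u}` (`laplacian_radVelQuot_add_eq`).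
For `div u = 0` this is Chen–Fang–Zhang's `‖∇̄²W‖₂ ≤ c‖Γ,₃‖₂` with `c = 1` and the full
Cartesian Hessian; for `u = ζv̄` the extra `q_{div u}` is Seregin's `C(v,η)`. Registered
sub-goal toward `stub_sereginLogSwirlOrigin`. [cite: Seregin2022LocalAxisym, §2 Lemma 2.1, second estimate (arXiv:2201.00153 p. 5)] [cite: LeiZhang2017, Lemma 2.1 (second estimate)] -/
theorem integral_hessianSq_radVelQuot_le_of_hasCompactSupport' : ∀ u : EuclideanSpace ℝ (Fin 3) → EuclideanSpace ℝ (Fin 3), ContDiff ℝ 5 u → HasCompactSupport u → IsAxisymmetric u → ∫ x, ∑ i : Fin 3, ∑ j : Fin 3, (fderiv ℝ (fun y => fderiv ℝ (radVelQuot u) y (EuclideanSpace.single i 1)) x (EuclideanSpace.single j 1)) ^ 2 ≤ ∫ x, (fderiv ℝ (angVortQuot u) x (EuclideanSpace.single 2 1) + radDerivQuot (VectorCalculus.divergence u) x) ^ 2 := by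
  intro u hu hc hax
  have hu2 : ContDiff ℝ 2 u := hu.of_le (by norm_num)
  have hu4 : ContDiff ℝ 4 u := hu.of_le (by norm_num)
  have hρ3 : ContDiff ℝ 3 (radVelQuot u) := contDiff_radVelQuot (n := 3) (by exact_mod_cast hu)
  have hρ2 : ContDiff ℝ 2 (radVelQuot u) := hρ3.of_le (by norm_num)
  have hρ1 : ContDiff ℝ 1 (radVelQuot u) := hρ3.of_le (by norm_num)
  have hρax : IsAxisymmetricScalar (radVelQuot u) := hax.isAxisymmetricScalar_radVelQuot hu2
  have hρc : HasCompactSupport (radVelQuot u) := hasCompactSupport_radVelQuot hu2 hax hc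
  have hq : MemLp (radDerivQuot (radVelQuot u)) 2 volume :=
    (continuous_radDerivQuot hρ2).memLp_of_hasCompactSupport
      (hasCompactSupport_radDerivQuot hρ2 hρax hρc)
  have hG := memLp_fderiv_apply_of_hasCompactSupport hρ1 hρc
  have hGG := memLp_fderiv_fderiv_apply_of_hasCompactSupport hρ2 hρc
  -- the partial derivatives `∂ᵢρ ∈ C²` are compactly supported
  have hGi2 : ∀ v : EuclideanSpace ℝ (Fin 3), ContDiff ℝ 2 fun y => fderiv ℝ (radVelQuot u) y v :=
    fun v => contDiff_fderiv_apply_const_succ (n := 2) (by exact_mod_cast hρ3) v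
  have hGic : ∀ v : EuclideanSpace ℝ (Fin 3),
      HasCompactSupport fun y => fderiv ℝ (radVelQuot u) y v := fun v => hρc.fderiv_apply ℝ v
  have hGGG : ∀ i j : Fin 3, MemLp (fun x => fderiv ℝ (fun y => fderiv ℝ (fun z =>
      fderiv ℝ (radVelQuot u) z (EuclideanSpace.single i 1)) y (EuclideanSpace.single j 1)) x
      (EuclideanSpace.single j 1)) 2 volume := fun i j =>
    memLp_fderiv_fderiv_apply_of_hasCompactSupport (hGi2 _) (hGic _) _ _
  have hqH : MemLp (radDerivQuot fun y => fderiv ℝ (radVelQuot u) y (EuclideanSpace.single 2 1))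
      2 volume :=
    (continuous_radDerivQuot (hGi2 _)).memLp_of_hasCompactSupport
      (hasCompactSupport_radDerivQuot (hGi2 _)
        (hρax.fderiv_apply_single_two (hρ2.differentiable two_ne_zero)) (hGic _))
  have hx0 := memLp_coord_mul_fderiv_radDerivQuot hρ3 hρax (Or.inl rfl) hq (hGG _ _)
  have hx1 := memLp_coord_mul_fderiv_radDerivQuot hρ3 hρax (Or.inr rfl) hq (hGG _ _)
  rw [integral_sum_sq_fderiv_fderiv_eq_integral_laplacian_sq_of_memLp hρ3 (fun i => hG _)
    (fun i j => hGG _ _) hGGG]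
  have h := integral_laplacian_sq_le hρ3 hρax hq (hG _) (hG _) (hG _) (hGG _ _) (hGG _ _)
    (hGG _ _) hx0 hx1 hqH
  refine h.trans_eq (integral_congr_ae (Eventually.of_forall fun x => ?_))
  simp only
  rw [laplacian_radVelQuot_add_eq u hax hu4 x]

/-- **Split form of the second estimate**: for every axisymmetric `u ∈ C⁵(ℝ³; ℝ³)` with compact
support, `∫ Σᵢⱼ (∂ⱼ∂ᵢ(u_r/r))² ≤ 2∫ (∂₃(ω_θ/r))² + 2∫ ((1/r)∂ᵣ(div u))²` — the previous bound
and `(a + b)² ≤ 2a² + 2b²`; with `u = ζv̄` this is Seregin's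
`‖∇̄²(ζv_r/r)‖₂ ≤ c‖(ζΓ),₃‖₂ + C(v,η)` before the identification `ω_θ(ζv̄)/r = ζΓ + …`.
[cite: Seregin2022LocalAxisym, §2 Lemma 2.1, second estimate (arXiv:2201.00153 p. 5)] -/
theorem integral_hessianSq_radVelQuot_le_two_mul_add (hu : ContDiff ℝ 5 u)
    (hc : HasCompactSupport u) (hax : IsAxisymmetric u) :
    ∫ x, ∑ i : Fin 3, ∑ j : Fin 3,
        (fderiv ℝ (fun y => fderiv ℝ (radVelQuot u) y (EuclideanSpace.single i 1)) x
          (EuclideanSpace.single j 1)) ^ 2 ≤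
      2 * (∫ x, fderiv ℝ (angVortQuot u) x (EuclideanSpace.single 2 1) ^ 2) +
        2 * ∫ x, radDerivQuot (VectorCalculus.divergence u) x ^ 2 := by
  have hu3 : ContDiff ℝ 3 u := hu.of_le (by norm_num)
  have hu4 : ContDiff ℝ 4 u := hu.of_le (by norm_num)
  have hω1 : ContDiff ℝ 1 (angVortQuot u) := contDiff_angVortQuot (n := 1) (by exact_mod_cast hu4)
  have hωc : HasCompactSupport (angVortQuot u) := hasCompactSupport_angVortQuot hu3 hax hc
  have hωz := memLp_fderiv_apply_of_hasCompactSupport hω1 hωc (EuclideanSpace.single 2 1)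
  have hqD : MemLp (radDerivQuot (VectorCalculus.divergence u)) 2 volume :=
    memLp_radDerivQuot_divergence hu4 hc hax
  refine (integral_hessianSq_radVelQuot_le_of_hasCompactSupport' u hu hc hax).trans ?_
  rw [← integral_const_mul, ← integral_const_mul,
    ← integral_add (hωz.integrable_sq.const_mul _) (hqD.integrable_sq.const_mul _)]
  refine integral_mono ((hωz.add hqD).integrable_sq)
    ((hωz.integrable_sq.const_mul _).add (hqD.integrable_sq.const_mul _)) fun x => ?_
  beta_reduce
  nlinarith [sq_nonneg (fderiv ℝ (angVortQuot u) x (EuclideanSpace.single 2 1) -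
    radDerivQuot (VectorCalculus.divergence u) x)]

end Summit.NavierStokesRegularity.NavierStokesRegularity.Theorems.AxisymmetricKatoGlobal.EulerScaling

end
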